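import Summits.PneNP.PneNP.Theorems.SymmetryBudgetWindowCanoniserBuildersDefs

/-!
# Window canoniser, IV: wiring of the main computation (definitions)

Route `PneNP/SymmetryBudget`, dichotomy `WindowBarrier` (stmt-PneNP-2145) / `NoHiddenOrder` (stmt-PneNP-14781);
continuation of `…WindowCanoniserBuildersDefs.lean` (see its module docstring for the families).  The argument
wires of the MAIN atoms of a label (`WCan.Kind.argsM`), and the assembled wiring of every atom and gate
(`WCan.Atom.args`, `WCan.Node.args`).
-/

-- `Summit.PneNP.PneNP.…` duplicates `PneNP` BY DESIGN (single-problem summit, D-0017 layout).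
set_option linter.dupNamespace false

noncomputable section

namespace Summit.PneNP.PneNP.Theorems

namespace WCan

open Finset Equiv Literature.Computability.Complexity

variable {K r n : ℕ}

/-! ### Wiring of the main atoms -/

section MainArgs

variable [NeZero n] (L : Lab K n)

/-- Wires of the main atoms of label `L` (replay families get dummy wires here).  Vertex slots `vs`,
numeric slots `ns`; `z = vs 0` doubles as the ambient vertex passed to parameter-free references. -/
def Kind.argsM (k : Kind) (P : Prm r n) : Fin (k.fn r n).1 → Wire K r n :=
  let U := L.1.U
  let T' : Fin (T n + 1) := tf n
  let ln : Fin (n + 1) := Fin.last n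
  let z : Fin n := P.vs 0
  match k with
  | .rkGE => cnt n P.s fun w' => w1 (n1and [pos (aW L T' w'), pos (aLT L T' w' (P.vs 0))])
  | .mtch =>
      Fin.append
        (Fin.append
          (fun v => match chLab L P with
            | none => wA ffA
            | some Lc => w2 (iffF (aW Lc P.it v) (aW L T' v)))
          (fun v => match chLab L P with
            | none => wA ffA
            | some Lc => w2 (iffF (aC Lc P.it v) (aC L T' v))))
        (fun i => match chLab L P with
          | none => wA ffA
          | some Lc => let u := (finProdFinEquiv.symm i).1; let w := (finProdFinEquiv.symm i).2
            w2 (iffF (aLT Lc P.it u w) (aLT L T' u w)))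
  | .thru => fun it : Fin (T n) =>
    match chLab L P with
    | none => wA ffA
    | some Lc =>
      let it' : Fin (T n + 1) := it.castSucc
      w1 (n1and ([pos (.lab L .mtch { P with it := it' }), neg (aFrz Lc it' z)] ++
        (if P.fl then [] else [pos (aSel Lc it' z)])))
  | .cert => fun a : Fin 4 =>
    match chLab L P with
    | none => wA ffA
    | some Lc =>
      if (a : ℕ) = 0 then wA (.lab L .thru { P with it := 0 })
      else if (a : ℕ) = 1 then wA (aARR Lc T' z)
      else if (a : ℕ) = 2 then wN (aDEAD Lc T' z)
      else w2 (nonbotF Lc z)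
  | .pcand => fun j : Fin n =>
    match candLab L (P.vs 0) P.h1 with
    | none => wA ffA
    | some Lc => w2 (n2and [litN1 (pos (aVbit Lc z (benc (.crk (P.ns 0) j)))), rkF Lc (P.vs 1) j, litN1 (pos (aW Lc T' (P.vs 1)))])
  | .lcrk => fun (w : Fin n) => w2 (n2and [litN1 (pos (aPcand L (P.vs 0, P.h1) (P.ns 0) w)), rkF L w (P.ns 1)])
  | .pfx => fun i : Fin (NB r n) =>
      if (i : ℕ) < P.b then w2 (iffF (lbitA L (P.vs 0, P.h1) i) (lbitA L (P.vs 1, P.h2) i)) else wA ttA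
  | .lexLE => fun i : Fin (NB r n + 1) =>
      let κ : Fin n × Fin (n + 1) := (P.vs 0, P.h1)
      let κ' : Fin n × Fin (n + 1) := (P.vs 1, P.h2)
      if h : (i : ℕ) < NB r n then
        let b : Fin (NB r n) := ⟨i, h⟩
        w1 (n1and [pos (aPfx L κ κ' i), neg (lbitA L κ b), pos (lbitA L κ' b)])
      else wA (aPfx L κ κ' (Fin.last _))
  | .best =>
    let κ : Fin n × Fin (n + 1) := (P.vs 0, P.h1)
    Fin.append
      (fun i : Fin (n * (n + 1)) => let κ' := finProdFinEquiv.symm i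
        w1 (n1or [neg (aCert L (Sum.inl κ') z), pos (aLexLE L κ κ')]))
      (fun _ : Fin 1 => wA (aCert L (Sum.inl κ) z))
  | .ivbit => fun i : Fin (n * (n + 1)) =>
    if h : (P.b : ℕ) < NB r n then
      let b : Fin (NB r n) := ⟨P.b, h⟩
      let κ := finProdFinEquiv.symm i
      w1 (n1and [pos (aBest L κ), pos (lbitA L κ b)])
    else wA ffA
  | .inonbot => fun i : Fin (n * (n + 1)) => wA (aCert L (Sum.inl (finProdFinEquiv.symm i)) z)
  | .isP => fun v : Fin n =>
    let u := P.vs 0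
    if u ∈ U ∧ P.us ⊂ U ∧ P.us.Nonempty then
      (if v ∈ P.us then wA (aReach L T' ln u v) else wN (aReach L T' ln u v))
    else wA ffA
  | .pcov => fun i : Fin (2 ^ n) => let U' := fsEnum n i
      w1 (n1and [pos (aIsP L (P.vs 0) U'), pos (aCert L (Sum.inr U') z)])
  | .pnonbot => fun u : Fin n => if u ∈ U then wA (aPcov L u) else wA ttA
  | .pbit => fun e : Fin (2 ^ n) =>
    if h : (P.bp : ℕ) < NBp r n then
      let i : Fin (NBp r n) := ⟨P.bp, h⟩
      let U' := fsEnum n e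
      match bpdec i with
      | Sum.inl s => w1 (n1and [pos (aIsP L (P.vs 0) U'), if U'.card = (s : ℕ) then pos ttA else pos ffA])
      | Sum.inr b =>
        match partLab L U' with
        | none => wA ffA
        | some Lc => w1 (n1and [pos (aIsP L (P.vs 0) U'), pos (aVbit Lc z b)])
    else wA ffA
  | .rkInGE => cnt n P.s fun w' : Fin n => if w' ∈ P.us then wA (aLT L T' w' (P.vs 0)) else wA ffA
  | .pcP => fun i : Fin (n * n) =>
    match partLab L P.us with
    | none => wA ffA
    | some Lc =>
      let w'' := (finProdFinEquiv.symm i).1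
      let j := (finProdFinEquiv.symm i).2
      if w'' ∈ P.us then
        w2 (n2and [litN1 (pos (aVbit Lc z (benc (.crk (P.ns 0) j)))),
          n1and [pos (aRkInGE L P.us w'' j.castSucc), neg (aRkInGE L P.us w'' j.succ)], EQF L w'' (P.vs 0)])
      else wA ffA
  | .ppc => fun e : Fin (2 ^ n) => let U' := fsEnum n e
      w1 (n1and [pos (aIsP L (P.vs 0) U'), pos (aPcP L U' (P.ns 0) (P.vs 1))])
  | .pcrk => fun (w : Fin n) => w2 (n2and [litN1 (pos (aPpc L (P.vs 0) (P.ns 0) w)), rkF L w (P.ns 1)])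
  | .ppfx => fun i : Fin (NBp r n) =>
      if (i : ℕ) < P.bp then w2 (iffF (pvecA L (P.vs 0) i) (pvecA L (P.vs 1) i)) else wA ttA
  | .plexLT => fun i : Fin (NBp r n) =>
      w1 (n1and [pos (aPpfx L (P.vs 0) (P.vs 1) i.castSucc), neg (pvecA L (P.vs 0) i), pos (pvecA L (P.vs 1) i)])
  | .pstGE => cnt n P.s fun w => w1 (n1and [pos (aW L T' w), pos (aPlexLT L w (P.vs 0))])
  | .pbcGE => cnt n P.s fun w => w1 (n1and [pos (aW L T' w), pos (aPlexEQ L w (P.vs 0))])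
  | .pat =>
    let u := P.vs 0
    let p := P.ns 0
    let i := P.ns 1
    let o := P.ns 2
    fun s : Fin (n + 1) =>
      if h : (o : ℕ) < s ∧ (i : ℕ) * s + o ≤ p ∧ ((i : ℕ) + 1) * s ≤ n then
        let t : Fin (n + 1) := ⟨(p : ℕ) - ((i : ℕ) * s + o), by omega⟩
        let t1 : Fin (n + 1) := ⟨(p : ℕ) - ((i : ℕ) * s + o) + 1, by omega⟩
        let bc : Fin (n + 1) := ⟨((i : ℕ) + 1) * s, by omega⟩
        w2 (n2and [n1and [pos (aPstGE L u t), neg (aPstGE L u t1)], litN1 (pos (aPbit L u (bpSize s))),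
          litN1 (pos (aPbcGE L u bc))])
      else wA ffA
  | .off => fun (i : Fin n) => wA (aPat L (P.ns 0) (P.vs 0) i (P.ns 1))
  | .blkI => fun (o : Fin n) => wA (aPat L (P.ns 0) (P.vs 0) (P.ns 1) o)
  | .samePart => fun k : Fin (n * n) =>
      let u := (finProdFinEquiv.symm k).1
      let i := (finProdFinEquiv.symm k).2
      w1 (n1and [pos (aBlkI L (P.ns 0) u i), pos (aBlkI L (P.ns 1) u i)])
  | .spc => fun k : Fin (n * n) =>
      let u := (finProdFinEquiv.symm k).1
      let o := (finProdFinEquiv.symm k).2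
      w1 (n1and [pos (aOff L (P.ns 0) u o), pos (aPpc L u o (P.vs 0))])
  | .svadj =>
    let p := P.ns 0
    let q := P.ns 1
    Fin.append
      (fun k : Fin (n * n * n) =>
        let u := (finProdFinEquiv.symm (finProdFinEquiv.symm k).1).1
        let o := (finProdFinEquiv.symm (finProdFinEquiv.symm k).1).2
        let o' := (finProdFinEquiv.symm k).2
        w1 (n1and [pos (aSamePart L p q z), pos (aOff L p u o), pos (aOff L q u o'),
          pos (aPbit L u (bpVal (benc (.adj o o'))))]))
      (fun k : Fin (n * n) =>
        let w := (finProdFinEquiv.symm k).1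
        let w' := (finProdFinEquiv.symm k).2
        w1 (n1and [neg (aSamePart L p q z), pos (aSpc L p w), pos (aSpc L q w'), pos (aSw L T' w w')]))
  | .svext => fun k : Fin (n * n) =>
    match P.o1 with
    | none => wA ffA
    | some o =>
      let u := (finProdFinEquiv.symm k).1
      let oo := (finProdFinEquiv.symm k).2
      w1 (n1and [pos (aOff L (P.ns 0) u oo), pos (aPbit L u (bpVal (benc (.ext oo o))))])
  | .svcrk => fun (w : Fin n) => w2 (n2and [litN1 (pos (aSpc L (P.ns 0) w)), rkF L w (P.ns 1)])
  | .vbit => fun _ =>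
    if h : (P.b : ℕ) < NB r n then
      let b : Fin (NB r n) := ⟨P.b, h⟩
      if U.card ≤ 1 then leafBitW L b
      else
        let inRange : Bool := match bdec b with
          | .adj p q => decide ((p : ℕ) < U.card ∧ (q : ℕ) < U.card)
          | .ext p _ => decide ((p : ℕ) < U.card)
          | .crk p _ => decide ((p : ℕ) < U.card)
        let svA : Atom K r n := match bdec b with
          | .adj p q => aSvadj L p q z
          | .ext p o => aSvext L p o z
          | .crk p j => aSvcrk L p j z
        if inRange then
          w2 (n2or [n1and [pos (aConn L T' z), pos (aIvbit L z b)], n1and [neg (aConn L T' z), pos svA]])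
        else wA ffA
    else wA ffA
  | _ => fun _ => wA ffA

end MainArgs

/-! ### The wiring of every gate -/

section Args

variable [NeZero n]

/-- The replay families. -/
def Kind.isReplay : Kind → Bool
  | .sW | .sLT | .sC | .sARR | .sDEAD | .frz | .now | .cnt1 | .sw | .reach | .conn | .szGE | .big | .bmc | .sel
  | .hasSel | .pok | .nWs | .fLT | .fcge | .fallb | .flex => true
  | _ => false

/-- **Wires of an atom.**  The output gate `outv b` is the `∨` of the `n` copies (one per ambient vertex) of the
root's value bit `b`. -/
def Atom.args : (a : Atom K r n) → Fin a.fn.1 → Wire K r n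
  | .tt => Fin.elim0
  | .ff => Fin.elim0
  | .oo o o' => fun a => if (a : ℕ) = 0 then Sum.inl (ov n o, ov n o') else Sum.inl (ov n o', ov n o)
  | .outv b => fun z : Fin n => wA (aVbit (Lab.root K n) z b)
  | .sh k P => k.args P
  | .lab L k P => if k.isReplay then k.argsR L P else k.argsM L P

/-- The wire of a literal. -/
def Lit.wire (l : Lit K r n) : Wire K r n := if l.2 then wA l.1 else wN l.1

/-- **Wires of a gate**: atoms by family; a negated atom reads its atom; formulas read their operands. -/
def Node.args : (l : Node K r n) → Fin l.fn.1 → Wire K r n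
  | .atom a => a.args
  | .natom a => fun _ => wA a
  | .f1 f => fun i => (f.ls i).wire
  | .f2 f => fun i => w1 (f.xs i)

end Args

end WCan

end Summit.PneNP.PneNP.Theorems

end
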